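import Summits.ValiantsHypothesis.ValiantsHypothesis.Theorems.LacunarySymmetroidMatrixDescartesCensusV20SoundGram
import Summits.ValiantsHypothesis.ValiantsHypothesis.Theorems.LacunarySymmetroidMatrixDescartesCensusNewtonCone
import Summits.ValiantsHypothesis.ValiantsHypothesis.Theorems.LacunarySymmetroidMatrixDescartesCensusDefs
import Summits.ValiantsHypothesis.ValiantsHypothesis.Theorems.LacunarySymmetroidMatrixDescartesCensusMirror

/-!
# `MatrixDescartes` census — soundness of the `V = 20` certificate checker: the coefficients of a hypothetical twenty on a checked support (full support, atom dictionary, alternation, Newton-cone rows)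

HONEST FRAMING.  Object-search cell `pub-symmetroid`; door-A item `DoorA26 = PosRootLawAt 2 6 19`
(stmt-ValiantsHypothesis-19979; OPEN, typed, never asserted).  Part of the proof that a certificate accepted by `V20.checkCell` (`…CensusV20Check`) excludes a twenty — `20 = D(2,6)` distinct
positive det-roots of a six-term real symmetric `2 × 2` pencil — on its support (semantics: `…CensusV20Model`).  Nothing here bears on `V = 19`, on `ζ_sym(2,6)` over all supports, on `DoorA26` itself, on `MatrixDescartes`
(stmt-ValiantsHypothesis-18050) or on `VP ≠ VNP`.

[folklore] Certificate-checker soundness / replay; elementary.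
-/

-- the D-0017 layout repeats a namespace component (single-conjunct summit); the `dupNamespace` linter flags it; name mandated.
set_option linter.dupNamespace false

namespace Summit.ValiantsHypothesis.ValiantsHypothesis.Theorems.LacunarySymmetroidMatrixDescartes.Census.V20

/-! ## Soundness, concrete layer (continued): coefficients of a hypothetical twenty, and the main theorems -/

section Main

open Polynomial Finset
open scoped BigOperators Polynomial Matrix
open Summit.ValiantsHypothesis.ValiantsHypothesis.Theorems.MatrixDescartes.Negative (PosRootLawAt)

variable {dl : List ℕ} {ord : List Atom}

/-! ### Consequences of `ordOK` -/

/-- The checked order, unpacked. [folklore] -/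
theorem ordOK_spec (h : ordOK dl ord = true) :
    dl.length = 6 ∧ ord.length = 21 ∧ (∀ a ∈ allAtoms, a ∈ ord) ∧ (∀ b ∈ ord, b ∈ allAtoms) ∧
      ord.Pairwise (fun a b => psum dl a < psum dl b) := by
  simpa [ordOK, Bool.and_eq_true, decide_eq_true_eq, and_assoc] using h

/-- `Epos` as a list access. [folklore] -/
theorem Epos_eq_getElem (h : ordOK dl ord = true) {t : ℕ} (ht : t < 21) :
    Epos dl ord t = psum dl (ord[t]'(by rw [(ordOK_spec h).2.1]; exact ht)) := by
  unfold Epos; rw [List.getD_eq_getElem]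

/-- Pair sums increase strictly with the position. [folklore] -/
theorem Epos_lt (h : ordOK dl ord = true) {t u : ℕ} (htu : t < u) (hu : u < 21) : Epos dl ord t < Epos dl ord u := by
  obtain ⟨-, hlen, -, -, hpw⟩ := ordOK_spec h
  rw [Epos_eq_getElem h (htu.trans hu), Epos_eq_getElem h hu]
  exact List.pairwise_iff_getElem.1 hpw t u (by rw [hlen]; omega) (by rw [hlen]; exact hu) htu

/-- Pair sums are monotone in the position. [folklore] -/
theorem Epos_le (h : ordOK dl ord = true) {t u : ℕ} (htu : t ≤ u) (hu : u < 21) : Epos dl ord t ≤ Epos dl ord u := by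
  rcases htu.eq_or_lt with rfl | hlt
  · exact le_rfl
  · exact (Epos_lt h hlt hu).le

/-- The pair sum at the position of an atom. [folklore] -/
theorem Epos_posOf (h : ordOK dl ord = true) {a : Atom} (ha : a ∈ allAtoms) : Epos dl ord (posOf a ord) = psum dl a := by
  unfold Epos; rw [getD_posOf ((ordOK_spec h).2.2.1 a ha)]

/-- Positions are `< 21`. [folklore] -/
theorem posOf_lt (h : ordOK dl ord = true) {a : Atom} (ha : a ∈ allAtoms) : posOf a ord < 21 := by
  have := posOf_lt_length ((ordOK_spec h).2.2.1 a ha)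
  rw [(ordOK_spec h).2.1] at this; exact this

/-- On a checked (2-Sidon) support the pair sum determines the atom. [folklore] -/
theorem psum_inj (h : ordOK dl ord = true) {a b : Atom} (ha : a ∈ allAtoms) (hb : b ∈ allAtoms)
    (hab : psum dl a = psum dl b) : a = b := by
  have h1 := Epos_posOf h ha
  have h2 := Epos_posOf h hb
  have hta := posOf_lt h ha
  have htb := posOf_lt h hb
  have heq : posOf a ord = posOf b ord := by
    by_contra hne
    rcases Nat.lt_or_gt_of_ne hne with hlt | hlt
    · have := Epos_lt h hlt htb; omega
    · have := Epos_lt h hlt hta; omega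
  have e1 : ord.getD (posOf a ord) (0, 0) = a := getD_posOf ((ordOK_spec h).2.2.1 a ha)
  have e2 : ord.getD (posOf b ord) (0, 0) = b := getD_posOf ((ordOK_spec h).2.2.1 b hb)
  rw [← e1, ← e2, heq]

/-- Pair sum of an off-diagonal atom. [folklore] -/
theorem psum_cA (dl : List ℕ) (i j : ℕ) : psum dl (cA i j) = dl.getD i 0 + dl.getD j 0 := by
  unfold cA psum; split_ifs <;> simp [add_comm]

/-- Entries of the order are atoms. [folklore] -/
theorem getElem_mem_allAtoms (h : ordOK dl ord = true) {t : ℕ} (ht : t < 21) :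
    (ord[t]'(by rw [(ordOK_spec h).2.1]; exact ht)) ∈ allAtoms :=
  (ordOK_spec h).2.2.2.1 _ (List.getElem_mem _)

/-! ### The support of a hypothetical twenty -/

variable {S : Fin 6 → Matrix (Fin 2) (Fin 2) ℝ}

/-- The support of the pencil determinant lies in the pair sums. [folklore] -/
theorem support_subset (h : ordOK dl ord = true) (S : Fin 6 → Matrix (Fin 2) (Fin 2) ℝ) :
    (pdet dl S).support ⊆ (Finset.range 21).image (Epos dl ord) := by
  intro c hc
  have hc' := support_det_pencil_subset_sumset (dfun dl) S hc
  rw [Finset.mem_image] at hc' ⊢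
  obtain ⟨g, -, rfl⟩ := hc'
  refine ⟨posOf (cA (g 0).val (g 1).val) ord, Finset.mem_range.2 (posOf_lt h (cA_mem (g 0).isLt (g 1).isLt)), ?_⟩
  rw [Epos_posOf h (cA_mem (g 0).isLt (g 1).isLt), psum_cA, Fin.sum_univ_two]
  rfl

/-- A twenty is not the zero polynomial. [folklore] -/
theorem pdet_ne_zero (h20 : 20 ≤ ((pdet dl S).roots.toFinset.filter (fun t => 0 < t)).card) : pdet dl S ≠ 0 := by
  intro h0; rw [h0] at h20; simp at h20

/-- A twenty has full support: all 21 pair sums. [folklore] -/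
theorem support_eq (h : ordOK dl ord = true) (h20 : 20 ≤ ((pdet dl S).roots.toFinset.filter (fun t => 0 < t)).card) :
    (pdet dl S).support = (Finset.range 21).image (Epos dl ord) ∧ (pdet dl S).support.card = 21 := by
  have hsub := support_subset h S
  have hlt := Literature.Computability.AlgebraicComplexity.card_roots_toFinset_filter_pos_lt_card_support
    (pdet_ne_zero h20)
  have hcard : ((Finset.range 21).image (Epos dl ord)).card ≤ 21 :=
    Finset.card_image_le.trans (by simp)
  have heq := Finset.eq_of_subset_of_card_le hsub (by omega)
  exact ⟨heq, by rw [heq]; have := Finset.card_le_card hsub; omega⟩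

/-- Every pair sum is in the support of a twenty. [folklore] -/
theorem Epos_mem_support (h : ordOK dl ord = true)
    (h20 : 20 ≤ ((pdet dl S).roots.toFinset.filter (fun t => 0 < t)).card) {t : ℕ} (ht : t < 21) :
    Epos dl ord t ∈ (pdet dl S).support := by
  rw [(support_eq h h20).1]
  exact Finset.mem_image.2 ⟨t, Finset.mem_range.2 ht, rfl⟩

/-- Every coefficient of a twenty is non-zero. [folklore] -/
theorem coeff_Epos_ne_zero (h : ordOK dl ord = true)
    (h20 : 20 ≤ ((pdet dl S).roots.toFinset.filter (fun t => 0 < t)).card) {t : ℕ} (ht : t < 21) :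
    (pdet dl S).coeff (Epos dl ord t) ≠ 0 :=
  Polynomial.mem_support_iff.1 (Epos_mem_support h h20 ht)

/-- A twenty is Descartes-sharp on its support. [folklore] -/
theorem sharp (h : ordOK dl ord = true) (h20 : 20 ≤ ((pdet dl S).roots.toFinset.filter (fun t => 0 < t)).card) :
    (pdet dl S).support.card ≤ ((pdet dl S).roots.toFinset.filter (fun t => 0 < t)).card + 1 := by
  rw [(support_eq h h20).2]; omega

/-! ### The dictionary: coefficients are atoms -/

/-- Auxiliary step `coeff_Epos` of the certificate-checker soundness proof. [folklore] -/
theorem coeff_Epos (h : ordOK dl ord = true) (hS : ∀ l, (S l).IsSymm) {t : ℕ} (ht : t < 21) :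
    (pdet dl S).coeff (Epos dl ord t) = aval S (ord.getD t (0, 0)) := by
  have hsym : ∀ l, S l 1 0 = S l 0 1 := fun l => by
    have e := congrFun (congrFun (hS l) 1) 0
    simp only [Matrix.transpose_apply] at e
    exact e.symm
  have hamem : ord.getD t (0, 0) ∈ allAtoms := by
    rw [List.getD_eq_getElem _ _ (by rw [(ordOK_spec h).2.1]; exact ht)]
    exact getElem_mem_allAtoms h ht
  generalize hadef : ord.getD t (0, 0) = a at hamem
  have hE : Epos dl ord t = psum dl a := by unfold Epos; rw [hadef]
  obtain ⟨i, j⟩ := a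
  obtain ⟨hij, hj⟩ : i ≤ j ∧ j < 6 := (mem_allAtoms_iff _).1 hamem
  have hi : i < 6 := by omega
  have hE' : Epos dl ord t = dfun dl ⟨i, hi⟩ + dfun dl ⟨j, hj⟩ := by rw [hE]; rfl
  -- uniqueness of the pair with this sum
  have huniq : ∀ p : Fin 6 × Fin 6, dfun dl p.1 + dfun dl p.2 = dfun dl ⟨i, hi⟩ + dfun dl ⟨j, hj⟩ →
      cA p.1.val p.2.val = (i, j) := by
    intro p hp
    apply psum_inj h (cA_mem p.1.isLt p.2.isLt) hamem
    rw [psum_cA]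
    exact hp
  unfold pdet
  rcases hij.eq_or_lt with rfl | hlt
  · -- diagonal atom
    rw [hE', coeff_det_pencil_two_diag (dfun dl) S ⟨i, hi⟩]
    · unfold aval qv; rw [if_pos rfl, fin6_eq hi, hsym]; ring
    · intro p hp
      have hc := huniq p hp
      unfold cA at hc
      obtain ⟨p1, p2⟩ := p
      split_ifs at hc with hle
      · simp only [Prod.mk.injEq] at hc
        exact Prod.ext (Fin.ext hc.1) (Fin.ext hc.2)
      · simp only [Prod.mk.injEq] at hc
        exact Prod.ext (Fin.ext hc.2) (Fin.ext hc.1)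
  · -- off-diagonal atom
    have hne : (⟨i, hi⟩ : Fin 6) ≠ ⟨j, hj⟩ := by intro e; simp at e; omega
    rw [hE', coeff_det_pencil_two_pair (dfun dl) S hne]
    · unfold aval bv; rw [if_neg hlt.ne, fin6_eq hi, fin6_eq hj, hsym, hsym]; ring
    · intro p hp
      have hc := huniq p hp
      unfold cA at hc
      obtain ⟨p1, p2⟩ := p
      split_ifs at hc with hle
      · simp only [Prod.mk.injEq] at hc
        exact Or.inl (Prod.ext (Fin.ext hc.1) (Fin.ext hc.2))
      · simp only [Prod.mk.injEq] at hc
        exact Or.inr (Prod.ext (Fin.ext hc.2) (Fin.ext hc.1))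

/-! ### Alternation and the sign pattern -/

/-- Adjacent coefficients of a twenty alternate in sign. [folklore] -/
theorem coeff_alternate (h : ordOK dl ord = true)
    (h20 : 20 ≤ ((pdet dl S).roots.toFinset.filter (fun t => 0 < t)).card) {t : ℕ} (ht : t + 1 < 21) :
    (pdet dl S).coeff (Epos dl ord t) * (pdet dl S).coeff (Epos dl ord (t + 1)) < 0 := by
  refine coeff_mul_coeff_neg_of_sharp _ (sharp h h20) (Epos_mem_support h h20 (by omega))
    (Epos_mem_support h h20 ht) (Epos_lt h (Nat.lt_succ_self t) ht) ?_
  intro c hc ⟨h1, h2⟩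
  rw [(support_eq h h20).1, Finset.mem_image] at hc
  obtain ⟨u, hu, rfl⟩ := hc
  rw [Finset.mem_range] at hu
  have hut : t < u := by
    by_contra hle; push Not at hle
    exact absurd h1 (not_lt.2 (Epos_le h hle (by omega)))
  have hut' : u < t + 1 := by
    by_contra hle; push Not at hle
    exact absurd h2 (not_lt.2 (Epos_le h hle hu))
  omega

/-- The sign pattern alternates. [folklore] -/
theorem negAt_succ (s : Bool) (t : ℕ) : negAt s (t + 1) = !negAt s t := by
  unfold negAt
  rcases Nat.mod_two_eq_zero_or_one t with h | h
  · have : (t + 1) % 2 = 1 := by omega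
    simp [h, this]
  · have : (t + 1) % 2 = 0 := by omega
    simp [h, this]

/-- The real sign alternates. [folklore] -/
theorem sgnR_succ (s : Bool) (t : ℕ) : sgnR s (t + 1) = -sgnR s t := by
  unfold sgnR; rw [negAt_succ]; cases negAt s t <;> simp

/-- The sign pattern of a twenty: with `s` the sign of the lowest coefficient, coefficient `t` has sign `s·(−1)^t`. [folklore] -/
theorem sign_pattern (h : ordOK dl ord = true)
    (h20 : 20 ≤ ((pdet dl S).roots.toFinset.filter (fun t => 0 < t)).card) :
    ∀ t, t < 21 → 0 < sgnR (decide (0 < (pdet dl S).coeff (Epos dl ord 0))) t * (pdet dl S).coeff (Epos dl ord t) := by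
  intro t
  induction t with
  | zero =>
    intro _
    have hne := coeff_Epos_ne_zero h h20 (show 0 < 21 by norm_num)
    unfold sgnR negAt
    by_cases hc : 0 < (pdet dl S).coeff (Epos dl ord 0)
    · simp [hc]
    · have hlt : (pdet dl S).coeff (Epos dl ord 0) < 0 := lt_of_le_of_ne (not_lt.1 hc) hne
      simp [hc]; linarith
  | succ t ih =>
    intro ht
    have h1 := ih (by omega)
    have h2 := coeff_alternate h h20 ht
    rw [sgnR_succ]
    have hg1 : sgnR (decide (0 < (pdet dl S).coeff (Epos dl ord 0))) t = 1 ∨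
        sgnR (decide (0 < (pdet dl S).coeff (Epos dl ord 0))) t = -1 := by
      unfold sgnR; split_ifs <;> simp
    rcases hg1 with e | e <;> rw [e] at h1 ⊢ <;> nlinarith

/-! ### Newton-cone rows in the checker's form -/

/-- The pair sums are distinct. [folklore] -/
theorem sums_nodup (h : ordOK dl ord = true) : (sums dl ord).Nodup := by
  have hpw := (ordOK_spec h).2.2.2.2
  have : (sums dl ord).Pairwise (· < ·) := by
    unfold sums; rw [List.pairwise_map]; exact hpw
  exact this.imp ne_of_lt

/-- The support of a twenty as the set of pair sums. [folklore] -/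
theorem support_eq_toFinset (h : ordOK dl ord = true)
    (h20 : 20 ≤ ((pdet dl S).roots.toFinset.filter (fun t => 0 < t)).card) :
    (pdet dl S).support = (sums dl ord).toFinset := by
  rw [(support_eq h h20).1]
  ext e
  rw [Finset.mem_image, List.mem_toFinset]
  unfold sums
  rw [List.mem_map]
  constructor
  · rintro ⟨u, hu, rfl⟩
    rw [Finset.mem_range] at hu
    refine ⟨ord[u]'(by rw [(ordOK_spec h).2.1]; exact hu), List.getElem_mem _, ?_⟩
    rw [Epos_eq_getElem h hu]
  · rintro ⟨b, hb, rfl⟩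
    have hb' := (ordOK_spec h).2.2.2.1 b hb
    exact ⟨posOf b ord, Finset.mem_range.2 (posOf_lt h hb'), Epos_posOf h hb'⟩

/-- `dist1` is the distance. [folklore] -/
theorem dist1_cast_of_ne {e u : ℕ} (hne : u ≠ e) : ((dist1 e u : ℕ) : ℝ) = |(e : ℝ) - u| := by
  unfold dist1
  rw [if_neg (Ne.symm hne)]
  split_ifs with hle
  · rw [Nat.cast_sub hle, abs_sub_comm, abs_of_nonneg (by simpa using hle)]
  · push Not at hle
    rw [Nat.cast_sub hle.le, abs_of_nonneg (by have := hle.le; simpa using this)]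

/-- The Newton-cone gap weight as the checker computes it. [folklore] -/
theorem weight_eq (h : ordOK dl ord = true)
    (h20 : 20 ≤ ((pdet dl S).roots.toFinset.filter (fun t => 0 < t)).card) (e : ℕ) :
    ∏ u ∈ (pdet dl S).support.erase e, |(e : ℝ) - u| = ((((sums dl ord).map (dist1 e)).prod : ℕ) : ℝ) := by
  rw [support_eq_toFinset h h20]
  have h1 : ∏ u ∈ (sums dl ord).toFinset.erase e, |(e : ℝ) - u|
      = ∏ u ∈ (sums dl ord).toFinset.erase e, ((dist1 e u : ℕ) : ℝ) :=
    Finset.prod_congr rfl fun u hu => (dist1_cast_of_ne (Finset.ne_of_mem_erase hu)).symm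
  rw [h1, Finset.prod_erase _ (by simp [dist1]), List.prod_toFinset _ (sums_nodup h), Nat.cast_list_prod,
    List.map_map]
  rfl

/-- `fval` with a constant exponent. [folklore] -/
theorem fval_map_const (L : List ℕ) (g : ℕ → ℕ) (e : ℕ) : fval (L.map fun u => (g u, e)) = (L.map g).prod ^ e := by
  induction L with
  | nil => simp [fval]
  | cons a L ih => rw [List.map_cons, fval_cons, ih, List.map_cons, List.prod_cons, mul_pow]

/-- Access to the sums list. [folklore] -/
theorem sums_getD (h : ordOK dl ord = true) {t : ℕ} (ht : t < 21) : (sums dl ord).getD t 0 = Epos dl ord t := by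
  unfold sums
  rw [List.getD_eq_getElem _ _ (by rw [List.length_map, (ordOK_spec h).2.1]; exact ht), List.getElem_map,
    Epos_eq_getElem h ht]

/-- The Newton-cone row `C25(t)` in the checker's form, for `x t = |coeff (E t)|`. [folklore] -/
theorem rowC25_of_twenty (h : ordOK dl ord = true)
    (h20 : 20 ≤ ((pdet dl S).roots.toFinset.filter (fun t => 0 < t)).card) (x : ℕ → ℝ)
    (hx : ∀ t, t < 21 → x t = |(pdet dl S).coeff (Epos dl ord t)|) {t : ℕ} (h1 : 1 ≤ t) (h19 : t ≤ 19) :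
    lprod x (rowC25 (sums dl ord) t).L * (fval (rowC25 (sums dl ord) t).Bden : ℝ)
      ≤ lprod x (rowC25 (sums dl ord) t).R * (fval (rowC25 (sums dl ord) t).Bnum : ℝ) := by
  have hpq : Epos dl ord (t - 1) < Epos dl ord t := Epos_lt h (by omega) (by omega)
  have hqr : Epos dl ord t < Epos dl ord (t + 1) := Epos_lt h (by omega) (by omega)
  have newton := newton_cone_coeff (pdet dl S) (sharp h h20) (Epos_mem_support h h20 (show t - 1 < 21 by omega))
    (Epos_mem_support h h20 (show t < 21 by omega)) (Epos_mem_support h h20 (show t + 1 < 21 by omega)) hpq hqr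
  rw [weight_eq h h20, weight_eq h h20, weight_eq h h20, ← hx (t - 1) (by omega), ← hx t (by omega),
    ← hx (t + 1) (by omega)] at newton
  generalize hp : Epos dl ord (t - 1) = p at newton hpq
  generalize hq : Epos dl ord t = q at newton hpq hqr
  generalize hr : Epos dl ord (t + 1) = r at newton hqr
  -- unfold the row
  have eL : (rowC25 (sums dl ord) t).L = List.replicate (r - q) (t - 1) ++ List.replicate (q - p) (t + 1) := by
    simp only [rowC25, sums_getD h (show t - 1 < 21 by omega), sums_getD h (show t < 21 by omega),
      sums_getD h (show t + 1 < 21 by omega), hp, hq, hr]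
  have eR : (rowC25 (sums dl ord) t).R = List.replicate (q - p + (r - q)) t := by
    simp only [rowC25, sums_getD h (show t - 1 < 21 by omega), sums_getD h (show t < 21 by omega),
      sums_getD h (show t + 1 < 21 by omega), hp, hq, hr]
  have eBnum : fval (rowC25 (sums dl ord) t).Bnum = ((sums dl ord).map (dist1 q)).prod ^ (q - p + (r - q)) := by
    simp only [rowC25, sums_getD h (show t - 1 < 21 by omega), sums_getD h (show t < 21 by omega),
      sums_getD h (show t + 1 < 21 by omega), hp, hq, hr]
    exact fval_map_const _ _ _
  have eBden : fval (rowC25 (sums dl ord) t).Bden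
      = ((sums dl ord).map (dist1 p)).prod ^ (r - q) * ((sums dl ord).map (dist1 r)).prod ^ (q - p) := by
    simp only [rowC25, sums_getD h (show t - 1 < 21 by omega), sums_getD h (show t < 21 by omega),
      sums_getD h (show t + 1 < 21 by omega), hp, hq, hr]
    rw [fval_append, fval_map_const, fval_map_const]
  rw [eL, eR, eBnum, eBden, lprod_append, lprod_replicate, lprod_replicate, lprod_replicate]
  simp only [Nat.cast_mul, Nat.cast_pow]
  rw [show r - p = q - p + (r - q) by omega] at newton
  rw [mul_pow, mul_pow, mul_pow] at newton
  have key := newton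
  ring_nf at key ⊢
  exact key

end Main

end Summit.ValiantsHypothesis.ValiantsHypothesis.Theorems.LacunarySymmetroidMatrixDescartes.Census.V20
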